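import Summits.BirchSwinnertonDyer.Rank1Residual.X1.KellerYinIMC2HalvesH1
import Summits.BirchSwinnertonDyer.Rank1Residual.X11b.RouteR1HalvesAllFrames
import Literature.NumberTheory.EllipticCurves.CastellaGrossiLeeSkinner2022.IMC2DivisibilityAndBDPValueFrame
import Literature.NumberTheory.EllipticCurves.SelmerCorankHolds
import HarnessLib

/-!
# Keller–Yin Thm. 3.0.8 at the good lattice — the two PUBLISHED-shaped inputs L-div and L-val
# DISCHARGED from print (CGLS 2022: proof of Thm. 4.2.2 first half, and Thm. 5.1.3), so
# `h308 ⇐ {four PUB named facts, L-μλ}` (cell `bsd-eis`, seat `bsd-eis-ky` gen 6; THEOREMS ONLY)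

HONEST FRAMING (FULL-BSD rank-≤1 programme D-0033, row A1 = class X1 ∩ {`r_an = 1`, type A}:
good ANOMALOUS Eisenstein prime, 7 892 census cells; route `EisensteinPrimes` crux rank 2
`GoodLatticeBDPValue` = stmt-BirchSwinnertonDyer-19032). `X1/KellerYinIMC2Halves.lean` (p407283)
reduces THEOREM A's one preprint input `h308` to H1 + L-div + L-μλ + L-val, and
`X1/KellerYinIMC2HalvesH1.lean` (p407831) proves H1 from Castella–Hsieh 2018. Here the remaining two
PUBLISHED-shaped inputs are PROVED from the registered Literature facts of
`CastellaGrossiLeeSkinner2022/IMC2DivisibilityAndBDPValueFrame.lean` (CGLS 2022, Invent. Math. 227):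

* §1 `goodLatticeDivOnTree_of_cgls` — L-div (`𝔛` torsion ∧ `p^k·L ∈ char_Λ(𝔛)·R₀⟦T⟧` at EVERY
  frame) from `proofThm422_exists_isBDPLFunction_isTorsion_charIdeal_dvd` (proof of Thm. 4.2.2, first
  half = Thm. 4.1.2 + Rem. 4.1.3 + Prop. 4.2.1 under (h1); ONE frame) by IDEAL RIGIDITY ACROSS
  PERIODS (`X11b.R1.span_singleton_eq_of_isBDPLFunction`: two frames of the same `(ι', v, κ, γ, f)`
  generate the same ideal of `R₀⟦T⟧`) and Carayol (`N = N_E`).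
* §2 `goodBDPValueOnTree_of_cgls` — L-val (`L(𝟙) = w·c_E⁻²(1 − a_p p⁻¹ + p⁻¹)²(log_{ω_E} P)²` at EVERY
  frame and for the datum's complex embedding `ι_ℂ`) from `thm513_exists_isBDPLFunction_valueAtOne`
  (Thm. 5.1.3; ONE frame, Heegner point read through THE infinite place `w₀`) by: the Galois
  re-reading `ι_ℂ = w₀ ∘ τ` for an involution `τ` of `K` (`exists_involution_map_eq`), VALUE RIGIDITY
  ACROSS PERIODS (`X11b.constantCoeff_eq_of_isBDPLFunction`: equal constant terms), and `(log_{ω_E}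
  τ_* P)² = (log_{ω_E} P)²` (`sq_padicLogOmega_map_eq_of_selmerCorank_eq_one`: if `P` is torsion both
  vanish; else `rank_ℤ E(K) = 1` from (Sel) corank `1` — `selmerCorank = rank + corank Ш`, PROVED in
  the tree — and `X11b.R1.sq_logOmega_map_eq_of_rank_one`).
* §3 `thm308_of_cgls_of_muLambda` — `h308` from FOUR PUBLISHED named facts (CH18 Def. 3.7/Prop. 3.8,
  Carayol, CGLS proof of 4.2.2 first half, CGLS Thm. 5.1.3) and ONE preprint statement L-μλ
  (`GoodLatticeMuLambdaOnTree`: `μ = 0` and `λ`-equality at an anomalous prime, Keller–Yin Thm. 1.5.1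
  + Thms. 2.2.1–2.2.3 — the cell's MEMO-1 §3A′/R2, referee PASS). So, in the kernel, the PREPRINT
  content of row A1 is EXACTLY ONE statement. Nothing asserted; no label moves; every consumer is
  CONDITIONAL on the named inputs.

References: [CastellaGrossiLeeSkinner2022] Thm. 4.1.2, Rem. 4.1.3, Prop. 4.2.1, proof of Thm. 4.2.2,
Thm. 5.1.3 (arXiv:2008.02571v2 TeX L2253–L2357, L2432–L2481); [CastellaHsieh2018] Def. 3.7,
Prop. 3.8; [Carayol1986]; [KellerYin2024] Thm. 3.0.8; HOME/bsd-eis-ky-MEMO-6.md, MEMO-7.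
-/

set_option autoImplicit false

noncomputable section

open scoped Classical

open PowerSeries WeierstrassCurve NumberField IsDedekindDomain Field
  Literature.NumberTheory.EllipticCurves Literature.NumberTheory.EllipticCurves.ModularForms
  Literature.NumberTheory.QuadraticFields Literature.NumberTheory.EllipticCurves.Rank1Residual
  Literature.NumberTheory.EllipticCurves.Castella2018
  Literature.NumberTheory.EllipticCurves.KellerYin2024
  Literature.NumberTheory.EllipticCurves.CastellaGrossiLeeSkinner2022
  Summit.BirchSwinnertonDyer.Rank1Residual.X11b.Halves
  Summit.BirchSwinnertonDyer.Rank1Residual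

namespace Summit.BirchSwinnertonDyer.Rank1Residual.X1.KellerYinHalves

/-! ## §0 Two bridges: the Galois re-reading of a Heegner datum, and `(log τ_* P)² = (log P)²` -/

section Bridges

variable {K : Type} [Field K] [NumberField K]

/-- **The Galois re-reading of a Heegner datum** (imaginary quadratic `K`): for a complex embedding
`ι_K` and an infinite place `w₀` there is an involution `τ` of `K` with `w₀.embedding ∘ τ = ι_K`, so
`τ_* P` reads through `w₀.embedding` whatever `P` reads through `ι_K`. [folklore] -/
-- adapted from `X11b.R1.exists_involution_map_eq` (route R1, erratum fields), with the field
-- hypothesis weakened to `IsImaginaryQuadratic K` and the infinite-order clause dropped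
theorem exists_involution_map_eq (hK : IsImaginaryQuadratic K) (ιK : K →+* ℂ) (w₀ : InfinitePlace K)
    {W : WeierstrassCurve ℚ} {N : ℕ} [NeZero N] (Dt : ModularParametrizationData W N)
    (H : HeegnerDatum N (NumberField.discr K)) {P : (W.baseChange K).toAffine.Point}
    (hP : WeierstrassCurve.Affine.Point.map ιK.toRatAlgHom P = heegnerPointComplex Dt H) :
    ∃ τ : K →+* K, (∀ x, τ (τ x) = x) ∧
      WeierstrassCurve.Affine.Point.map w₀.embedding.toRatAlgHom
          (WeierstrassCurve.Affine.Point.map τ.toRatAlgHom P) = heegnerPointComplex Dt H := by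
  haveI : IsGalois ℚ K := by
    haveI : Algebra.IsQuadraticExtension ℚ K := ⟨hK.1⟩
    infer_instance
  obtain ⟨σ, hσ⟩ := ComplexEmbedding.exists_comp_symm_eq_of_comp_eq (k := ℚ) w₀.embedding ιK
    (by ext x; simp)
  set τ : K →+* K := ((σ.symm : K ≃ₐ[ℚ] K) : K →+* K) with hτdef
  have hτ : ∀ x, τ (τ x) = x := by
    intro x
    have hcard : Nat.card (K ≃ₐ[ℚ] K) = 2 := by rw [IsGalois.card_aut_eq_finrank, hK.1]
    have hsq : σ.symm * σ.symm = 1 := by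
      have h := pow_card_eq_one' (G := K ≃ₐ[ℚ] K) (x := σ.symm)
      rwa [hcard, pow_two] at h
    have := congrArg (fun g : K ≃ₐ[ℚ] K ↦ g x) hsq
    simpa [hτdef, AlgEquiv.mul_apply] using this
  refine ⟨τ, hτ, ?_⟩
  rw [WeierstrassCurve.Affine.Point.map_map]
  have hcomp : w₀.embedding.toRatAlgHom.comp τ.toRatAlgHom = ιK.toRatAlgHom := by
    apply AlgHom.ext
    intro x
    have := RingHom.congr_fun hσ x
    simpa [hτdef] using this
  rw [hcomp]
  exact hP

variable (W : WeierstrassCurve ℚ) [W.IsElliptic] [W.IsGloballyMinimal] (p : ℕ) [Fact p.Prime]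
  (ι : K →+* ℚ_[p])

/-- **`(log_{ω_E} τ_* P)² = (log_{ω_E} P)²` when `corank_{ℤ_p} Sel_{p^∞}(E/K) = 1`** (involution `τ`
of `K`, any `P ∈ E(K)`): if `P` is torsion both logarithms vanish (`X11b.R1.logOmega_eq_zero_iff`);
otherwise `rank_ℤ E(K) = 1` — `≥ 1` by `P` (Mordell–Weil), `≤ 1` by `corank Sel = rank + corank Ш`
(`selmerCorank_eq_mordellWeilRank_add_holds`, PROVED) — and `X11b.R1.sq_logOmega_map_eq_of_rank_one`
applies. (`Castella2018.padicLogOmega` and `X11b.Halves.logOmega` have the same body.)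
[cite: SilvermanAEC2009, VIII.6.7 and IV.6.4] [cite: Greenberg1999, §1 (p. 53)] -/
theorem sq_padicLogOmega_map_eq_of_selmerCorank_eq_one (hSel : (W.baseChange K).selmerCorank p = 1)
    (τ : K →+* K) (hτ : ∀ x, τ (τ x) = x) (P : (W.baseChange K).toAffine.Point) :
    padicLogOmega W p ι (WeierstrassCurve.Affine.Point.map τ.toRatAlgHom P) ^ 2 =
      padicLogOmega W p ι P ^ 2 := by
  change logOmega W p ι (WeierstrassCurve.Affine.Point.map τ.toRatAlgHom P) ^ 2 = logOmega W p ι P ^ 2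
  by_cases hfin : IsOfFinAddOrder P
  · have h1 : logOmega W p ι P = 0 := (X11b.R1.logOmega_eq_zero_iff W p ι P).mpr hfin
    have h2 : logOmega W p ι (WeierstrassCurve.Affine.Point.map τ.toRatAlgHom P) = 0 :=
      (X11b.R1.logOmega_eq_zero_iff W p ι _).mpr
        ((WeierstrassCurve.Affine.Point.map τ.toRatAlgHom).isOfFinAddOrder hfin)
    rw [h1, h2]
  · haveI : (W.baseChange K).IsElliptic := by rw [baseChange]; infer_instance
    have hfg : Module.Finite ℤ (W.baseChange K).toAffine.Point :=
      (W.baseChange K).module_finite_point_holds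
    have h1 : 1 ≤ (W.baseChange K).mordellWeilRank :=
      one_le_mordellWeilRank_of_not_isOfFinAddOrder _ hfg hfin
    have h2 : (W.baseChange K).mordellWeilRank ≤ 1 := by
      have h := (W.baseChange K).selmerCorank_eq_mordellWeilRank_add_holds p
      omega
    exact X11b.R1.sq_logOmega_map_eq_of_rank_one W p ι τ hτ (le_antisymm h2 h1) hfin

end Bridges

/-! ## §1 L-div from print -/

/-- **L-div DISCHARGED from CGLS 2022 (proof of Thm. 4.2.2, first half).** On the data of `h308`
and at EVERY frame `L`: `𝔛` is `Λ`-torsion and `p^k · L ∈ char_Λ(𝔛)·R₀⟦T⟧` for some `k`. Per datum: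
Carayol (`hC`) gives `N = N_W`, hence `p ∤ N` and (Heeg) for `N`; `p` splits; the fact (`hdiv`,
Thm. 4.1.2 + Rem. 4.1.3 + Prop. 4.2.1 under (h1)) gives ONE frame `L₀` of `(ι', v, κ, γ, f)` with the
divisibility along `toUnr : ℤ_p → R₀` (`coe_toUnr`); IDEAL RIGIDITY ACROSS PERIODS
(`X11b.R1.span_singleton_eq_of_isBDPLFunction`: `p` odd, `K` imaginary quadratic, `κ`
anticyclotomic, periods non-zero) gives `(L) = (L₀)`, so `L = a·L₀` and `p^k·L = a·(p^k·L₀)` lies in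
the extended characteristic ideal. CONDITIONAL on the two named PUBLISHED facts.
[cite: CastellaGrossiLeeSkinner2022, proof of Thm. 4.2.2 (TeX L2343–L2352), Thm. 4.1.2, Rem. 4.1.3, Prop. 4.2.1] [cite: Carayol1986] -/
theorem goodLatticeDivOnTree_of_cgls
    (hdiv : proofThm422_exists_isBDPLFunction_isTorsion_charIdeal_dvd)
    (hC : ∀ (N : ℕ) [NeZero N], IsNewformOf.level_eq_conductorNorm (N := N))
    (W : WeierstrassCurve ℚ) [W.IsElliptic] [W.IsGloballyMinimal] (p : ℕ) [Fact p.Prime] :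
    GoodLatticeDivOnTree W p := by
  intro hp hgood hred _han _hGL K _ _ hK hHN hHp hodd h3 hEK hSel ι v vbar _hv hvbar hne κ hκ γ _ N _
    Dt H ιC P _hP ι' hι' ΩK Ωp L hΩK hL
  have hp2 : p ≠ 2 := by omega
  -- the level is the conductor: `p ∤ N` and (Heeg) for `N`
  have hN : N = W.conductorNorm ℤ := hC N Dt.isNewformOf
  have hpN : ¬ p ∣ N := by
    rw [hN, W.dvd_conductorNorm_iff_not_hasGoodReductionAtPrime p, not_not]
    exact hgood
  have hHeeg : SatisfiesHeegnerHypothesis N K := by rw [hN]; exact hHN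
  have hsplit : ((Ideal.span {(p : ℤ)}).primesOver (𝓞 K)).ncard = 2 := hHp p Fact.out (dvd_refl p)
  -- the published frame with torsion + divisibility
  obtain ⟨ΩK₀, Ωp₀, L₀, hΩK₀, hL₀, htors, hj⟩ := hdiv ι' W K v vbar κ γ Dt.isNewformOf hp2 hpN hred hK
    hHeeg hsplit hodd h3 hEK hSel hι' hvbar hne hκ
  obtain ⟨k, hk⟩ := hj (toUnr p) (coe_toUnr p)
  refine ⟨htors, k, ?_⟩
  -- ideal rigidity: `(L) = (L₀)`
  have hΩp : ((Ωp : unrIntegers p) : ℂ_[p]) ≠ 0 := by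
    rw [Ne, ZeroMemClass.coe_eq_zero]; exact Units.ne_zero Ωp
  have hΩp₀ : ((Ωp₀ : unrIntegers p) : ℂ_[p]) ≠ 0 := by
    rw [Ne, ZeroMemClass.coe_eq_zero]; exact Units.ne_zero Ωp₀
  have hspan : Ideal.span ({L} : Set (UnrSeries p)) = Ideal.span {L₀} :=
    X11b.R1.span_singleton_eq_of_isBDPLFunction hp2 hK hκ Fact.out hΩK₀ hΩK hΩp₀ hΩp hL₀ hL
  have hmem : L ∈ Ideal.span ({L₀} : Set (UnrSeries p)) := hspan ▸ Ideal.mem_span_singleton_self L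
  obtain ⟨a, ha⟩ := Ideal.mem_span_singleton'.mp hmem
  rw [← ha, mul_left_comm]
  exact Ideal.mul_mem_left _ a hk

/-! ## §2 L-val from print -/

/-- **L-val DISCHARGED from CGLS 2022 Thm. 5.1.3 (Bertolini–Darmon–Prasanna).** On the data of
`h308` and at EVERY frame `L`: `L(𝟙) = w · c_E⁻² (1 − a_p p⁻¹ + p⁻¹)² (log_{ω_E} P)²` with `w ∈ R₀ˣ`,
where `log_{ω_E}` is read at `v` through `ι` and `P` through the datum's complex embedding `ι_ℂ`.
Per datum: `ι_ℂ = w₀.embedding ∘ τ` for an involution `τ` (`exists_involution_map_eq`), so the fact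
(`hval`, Thm. 5.1.3 on a frame, Heegner point read through THE infinite place `w₀`) applies to
`τ_* P` and gives ONE frame `L₀` with `L₀(𝟙) = u · c_E⁻²(…)²(log_{ω_E} τ_* P)²`; VALUE RIGIDITY ACROSS
PERIODS (`X11b.constantCoeff_eq_of_isBDPLFunction`) gives `[T⁰]L = [T⁰]L₀`; and `(log_{ω_E} τ_* P)² =
(log_{ω_E} P)²` (`sq_padicLogOmega_map_eq_of_selmerCorank_eq_one`, from (Sel) corank `1`). Carayol
(`hC`) supplies `p ∤ N` and (Heeg) for `N`. CONDITIONAL on the two named PUBLISHED facts.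
[cite: CastellaGrossiLeeSkinner2022, Thm. 5.1.3 (TeX `thmpadicGZ`, L2463–L2471) with §5.1.2] [cite: BertoliniDarmonPrasanna2013, Thm. 5.13] [cite: Carayol1986] -/
theorem goodBDPValueOnTree_of_cgls (hval : thm513_exists_isBDPLFunction_valueAtOne)
    (hC : ∀ (N : ℕ) [NeZero N], IsNewformOf.level_eq_conductorNorm (N := N))
    (W : WeierstrassCurve ℚ) [W.IsElliptic] [W.IsGloballyMinimal] (p : ℕ) [Fact p.Prime] :
    GoodBDPValueOnTree W p := by
  intro hp hgood _hred _han _hGL K _ _ hK hHN hHp _hodd _h3 _hEK hSel ι v vbar hv _hvbar _hne κ hκ γ _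
    N _ Dt H ιC P hP ι' hι' ΩK Ωp L hΩK hL
  have hp2 : p ≠ 2 := by omega
  -- the level is the conductor: `p ∤ N` and (Heeg) for `N`
  have hN : N = W.conductorNorm ℤ := hC N Dt.isNewformOf
  have hpN : ¬ p ∣ N := by
    rw [hN, W.dvd_conductorNorm_iff_not_hasGoodReductionAtPrime p, not_not]
    exact hgood
  have hHeeg : SatisfiesHeegnerHypothesis N K := by rw [hN]; exact hHN
  have hsplit : ((Ideal.span {(p : ℤ)}).primesOver (𝓞 K)).ncard = 2 := hHp p Fact.out (dvd_refl p)
  -- `p ∈ v`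
  have hpv : ((p : ℕ) : 𝓞 K) ∈ v.asIdeal := by
    rw [hv]
    have h1 : ((((p : ℕ) : 𝓞 K) : K)) = (p : K) := by push_cast; rfl
    rw [h1, map_natCast, Padic.norm_p]
    exact inv_lt_one_of_one_lt₀ (by exact_mod_cast (Fact.out : p.Prime).one_lt)
  -- the Galois re-reading of the datum through THE infinite place
  set w₀ : InfinitePlace K := Classical.arbitrary (InfinitePlace K)
  obtain ⟨τ, hτ, hP'⟩ := exists_involution_map_eq hK ιC w₀ Dt H hP
  -- the published frame at `τ_* P`, with its value at `𝟙`
  obtain ⟨ΩK₀, Ωp₀, L₀, hΩK₀, hL₀, u, hu⟩ := hval ι' W K v κ γ Dt H w₀ ι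
    (WeierstrassCurve.Affine.Point.map τ.toRatAlgHom P) hp2 hpN hK hsplit hpv hι' hHeeg hκ Fact.out
    hP' hv
  -- value rigidity across periods: equal constant terms
  have hΩp : ((Ωp : unrIntegers p) : ℂ_[p]) ≠ 0 := by
    rw [Ne, ZeroMemClass.coe_eq_zero]; exact Units.ne_zero Ωp
  have hΩp₀ : ((Ωp₀ : unrIntegers p) : ℂ_[p]) ≠ 0 := by
    rw [Ne, ZeroMemClass.coe_eq_zero]; exact Units.ne_zero Ωp₀
  have hcc : PowerSeries.constantCoeff L = PowerSeries.constantCoeff L₀ :=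
    X11b.constantCoeff_eq_of_isBDPLFunction hp2 hK hκ Fact.out hΩK₀ hΩK hΩp₀ hΩp hL₀ hL
  -- `(log τ_* P)² = (log P)²`
  have hlog := sq_padicLogOmega_map_eq_of_selmerCorank_eq_one W p ι hSel τ hτ P
  refine ⟨u, ?_⟩
  have hv0 := UnrSeries.eq_constantCoeff_of_hasValueAt_zero hu
  have h0 := UnrSeries.hasValueAt_zero L
  rw [hcc, ← hv0, hlog] at h0
  exact h0

/-! ## §3 `h308` from four published named facts and the one preprint statement -/

/-- **`h308` ⇐ {CH18 existence, Carayol, CGLS proof of 4.2.2 (first half), CGLS Thm. 5.1.3} (all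
PUBLISHED named facts) + L-μλ (Keller–Yin Thm. 1.5.1 + Thms. 2.2.1–2.2.3: THE preprint content).**
`thm308_of_castellaHsieh2018_of_halves` with L-div and L-val discharged by §1–§2. So in the kernel
the preprint content of THEOREM A (row A1) is EXACTLY ONE statement, `GoodLatticeMuLambdaOnTree`.
CONDITIONAL on the named inputs; nothing booked, no label moves.
[cite: KellerYin2024, Thm. 3.0.8 (IMC2), Thm. 1.5.1, Thms. 2.2.1–2.2.3]
[cite: CastellaGrossiLeeSkinner2022, Thm. 4.1.2, Rem. 4.1.3, Prop. 4.2.1, Thm. 5.1.3]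
[cite: CastellaHsieh2018, Def. 3.7 and Prop. 3.8] [cite: Carayol1986] -/
theorem thm308_of_cgls_of_muLambda (hCH : castellaHsieh2018_exists_isBDPLFunction)
    (hC : ∀ (N : ℕ) [NeZero N], IsNewformOf.level_eq_conductorNorm (N := N))
    (hdiv : proofThm422_exists_isBDPLFunction_isTorsion_charIdeal_dvd)
    (hval : thm513_exists_isBDPLFunction_valueAtOne)
    (hml : ∀ (W : WeierstrassCurve ℚ) [W.IsElliptic] [W.IsGloballyMinimal] (p : ℕ) [Fact p.Prime],
      GoodLatticeMuLambdaOnTree W p) :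
    thm308_imc2_bdpValue_goodLattice_OPEN :=
  thm308_of_castellaHsieh2018_of_halves hCH hC (fun W _ _ p _ ↦ goodLatticeDivOnTree_of_cgls hdiv hC W p)
    hml (fun W _ _ p _ ↦ goodBDPValueOnTree_of_cgls hval hC W p)

end Summit.BirchSwinnertonDyer.Rank1Residual.X1.KellerYinHalves

end
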